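import Literature.AnabelianGeometry.EtaleTheta.SettingModelTateInversionRecentred
import HarnessLib

/-!
# Iterated deck displays: `ContH1.conj` along powers `σ^n` (generic), and the stage-2 («Tate shear») model of [EtTh] §1
# at the powers `σ₀^n` of the deck generator — print's `Z`-action for EVERY `a ∈ Z`, the re-centring displays at
# `σ₀^{1−i}`, and the defect of the inversion of record on `log(Ü)` at general `(i, j)` (proof-only)

S. Mochizuki, *The étale theta function and its Frobenioid-theoretic manifestations*, Publ. RIMS **45** (2009) [EtTh], §1,
Prop. 1.5 (iii), PRIMS PDF p. 23 (printed 249): «… on which `a ∈ Z` acts as follows: `η̈^Θ ↦ η̈^Θ − 2a·log(Ü) − (a²/2)·log(q_X)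
+ log(O^×_K̈)`, `log(Ü) ↦ log(Ü) + (a/2)·log(q_X) + log(O^×_K̈)`»; «Similarly, any inversion automorphism ι of Π^tp_Y — i.e.,
an automorphism lying over the action of “−1” on the underlying elliptic curve of X^log which fixes the irreducible component
of the special fiber of Y labeled 0 — fixes η̈^Θ + log(O^×_K̈), but maps log(Ü) + log(O^×_K̈) to −log(Ü) + log(O^×_K̈)»
[cite: MochizukiEtTh2009, Prop 1.5 (iii) p.23].  abc-iut cell, layer L2, seat abc-iut-L2-t12 (gen 11); row «TWIST-FAMILY@stage-2»,
file (A) of three.  PROOF-ONLY: no definition, no instance, no `Prop` fact; everything BY NAME over abc-iut-L6-t12's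
`ContH1.conj` action API (`conj_mul_apply`, `conj_one_apply`, `conj_bijective`), abc-iut-L2-t6's one-step display
`conj_deckGen_logUdd` (`σ₀·log Ü = log Ü · κ̈(q̈) · κ̈(1)`, `j = 2`) / `coe_kummerContCocycle_qdd_apply` / `kumYdd_toKddHat_qddUnit_eq_mk`
/ `yCoordKitχq`, this seat's gen-6 `conj_deckGen_zClassYddχq_gen` (`σ₀·x′ = x′·log(Ü)^{−2}·κ̈(q̈)^{−i}`, every `(i, j)`),
abc-iut-w5-d249's `yCoordχq_inversionχq` (defect exponent `−i −i + j`), abc-iut-L2-d1's `isInversionAut_inversionχq`, abc-iut-L2-t1's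
`transport` / `IsInversionAut.transportFun_apply`, and gen 10's `conj_kumYdd_qddUnit_of_aug_eq_one` (p505401).

GENERIC (`namespace ContH1`, any `H¹(H, A)` with the conjugation action of `G ⊵ H`): if `conj σ` fixes `Q`, multiplies `L` by
`Q^k` and sends `x ↦ x · L^{−2} · Q^{−c}`, then for EVERY `n ∈ ℤ`
* `conj_zpow_apply_eq_self` — `conj (σ^n) Q = Q`;
* `conj_zpow_apply_of_mul_zpow` — `conj (σ^n) L = L · Q^{k·n}` (`conj_zpow_apply_of_mul`: `k = 1`);
* **`conj_zpow_apply_of_display`** — `conj (σ^n) x = x · L^{−2n} · Q^{−(n(n−1)·k + n·c)}` (`conj_zpow_apply_of_display_one`: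
  `k = 1`; print's quadratic term is the case `k = c = 1`: `n(n−1) + n = n²`).
STAGE-2 MODEL (`namespace SettingModel`; `σ₀ = (a, 1)` the deck generator, `L = log(Ü)`, `Q = κ̈(q̈)`, `x′ = zClassYddχq`):
* `conj_toTheta_zpow_deckGen_logUdd` (`j = 2`) — `σ₀^n·L = L·Q^n`; `conj_toTheta_zpow_deckGen_zClassYddχq` (`j = 2`) —
  `σ₀^n·x′ = x′·L^{−2n}·Q^{−(n(n−1) + n·i)}`; hence for the TWISTED lift `x_m = x′·L^m`:
  **`conj_toTheta_zpow_deckGen_twistLift`** — `σ₀^n·x_m = x_m·L^{−2n}·Q^{−(n(n−1) + n·i − n·m)}`, in particular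
  **`conj_toTheta_zpow_deckGen_twistLift_line`** (`m = i − 1`) — `σ₀^n·x_{i−1} = x_{i−1}·L^{−2n}·Q^{−n²}` = print's display for
  EVERY `a = n ∈ Z` with trivial unit; and the RE-CENTRING displays at `n = 1 − i`:
  `conj_toTheta_deckGen_zpow_one_sub_logUdd` (`σ₀^{1−i}·L = L·Q^{1−i}`), `conj_toTheta_deckGen_zpow_one_sub_zClassYddχq`
  (`σ₀^{1−i}·x′ = x′·L^{2(i−1)}` — NO `Q`);
* **`transport_inflTheta_logUdd_kummerCoreχq_gen`** (every `i`, every even `j`, every theta companion) — along the inversion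
  OF RECORD, `ι_* infl(log Ü) = infl(log Ü)^{−1} · infl(Q)^{j/2 − i}` (p505401's `(2, 2)` case: exponent `−1`; abc-iut-L2-d1's
  defect-free line `j = 2i`: exponent `0`).
HONEST FRAMING: SEMI-SYNTHETIC model — consistency / non-vacuity evidence for the typed interface ONLY; [EtTh] is refereed and
nothing of it is disputed or asserted; typed ≠ proved; inhabited-at-a-model ≠ proved; no side taken on [IUTchIII] Cor. 3.12.
-/

noncomputable section

namespace Literature.AnabelianGeometry.EtaleTheta

/-! ## Generic: `ContH1.conj` along the powers `σ^n` -/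

namespace ContH1

variable {G G' : Type*} [Group G] [TopologicalSpace G] [IsTopologicalGroup G]
  [Group G'] [TopologicalSpace G'] [IsTopologicalGroup G']
  {φ : G →* G'} {A : Subgroup G'} [A.Normal] [IsMulCommutative A] {H : Subgroup G} [H.Normal]

/-- `ℤ`-induction along a step EQUIVALENCE (both directions from one recurrence). [folklore] -/
private theorem int_induction_iff {P : ℤ → Prop} (h0 : P 0) (hstep : ∀ m : ℤ, P m ↔ P (m + 1)) (n : ℤ) : P n := by
  induction n using Int.induction_on with
  | zero => exact h0
  | succ m ih => exact (hstep m).1 ih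
  | pred m ih => exact (hstep (-(m : ℤ) - 1)).2 (by rwa [sub_add_cancel])

/-- `conj (σ^(m+1)) = conj σ ∘ conj (σ^m)` on classes. [cite: NeukirchSchmidtWingberg2008, I §5] -/
theorem conj_zpow_add_one_apply (σ : G) (m : ℤ) (x : ContH1 φ A H) :
    conj φ A (σ ^ (m + 1)) x = conj φ A σ (conj φ A (σ ^ m) x) := by
  rw [add_comm, zpow_one_add, conj_mul_apply]

/-- **A class fixed by `conj σ` is fixed by `conj (σ^n)`**, every `n ∈ ℤ`. [cite: NeukirchSchmidtWingberg2008, I §5] -/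
theorem conj_zpow_apply_eq_self {σ : G} {Q : ContH1 φ A H} (hQ : conj φ A σ Q = Q) (n : ℤ) :
    conj φ A (σ ^ n) Q = Q := by
  refine int_induction_iff (P := fun n => conj φ A (σ ^ n) Q = Q) (by rw [zpow_zero, conj_one_apply]) (fun m => ?_) n
  rw [conj_zpow_add_one_apply]
  constructor
  · intro h
    rw [h, hQ]
  · intro h
    exact (conj_bijective σ).1 (h.trans hQ.symm)

/-- Commutative-group bookkeeping for the `L`-iterate. [folklore] -/
private theorem iterate_mul_algebra {M : Type*} [CommGroup M] (L Q : M) (k m : ℤ) :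
    L * Q ^ k * Q ^ (k * m) = L * Q ^ (k * (m + 1)) := by
  apply Additive.ofMul.injective
  simp only [ofMul_mul, ofMul_zpow]
  module

/-- **Iterated multiplicative display**: if `conj σ` fixes `Q` and sends `L ↦ L · Q^k`, then `conj (σ^n) L = L · Q^{k·n}` for
every `n ∈ ℤ` (print: «`log(Ü) ↦ log(Ü) + (a/2)·log(q_X)`» for every `a ∈ Z`). [cite: MochizukiEtTh2009, Prop 1.5 (iii) p.23] -/
theorem conj_zpow_apply_of_mul_zpow {σ : G} {L Q : ContH1 φ A H} (hQ : conj φ A σ Q = Q) {k : ℤ}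
    (hL : conj φ A σ L = L * Q ^ k) (n : ℤ) : conj φ A (σ ^ n) L = L * Q ^ (k * n) := by
  refine int_induction_iff (P := fun n => conj φ A (σ ^ n) L = L * Q ^ (k * n))
    (by rw [zpow_zero, conj_one_apply, mul_zero, zpow_zero, mul_one]) (fun m => ?_) n
  have step : conj φ A σ (L * Q ^ (k * m)) = L * Q ^ (k * (m + 1)) := by
    rw [map_mul, map_zpow, hL, hQ]
    exact iterate_mul_algebra L Q k m
  rw [conj_zpow_add_one_apply]
  constructor
  · intro h
    rw [h, step]
  · intro h
    exact (conj_bijective σ).1 (h.trans step.symm)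

/-- The case `k = 1`: `conj σ L = L · Q` gives `conj (σ^n) L = L · Q^n`. [cite: MochizukiEtTh2009, Prop 1.5 (iii) p.23] -/
theorem conj_zpow_apply_of_mul {σ : G} {L Q : ContH1 φ A H} (hQ : conj φ A σ Q = Q) (hL : conj φ A σ L = L * Q)
    (n : ℤ) : conj φ A (σ ^ n) L = L * Q ^ n := by
  have h := conj_zpow_apply_of_mul_zpow hQ (k := 1) (by rw [zpow_one]; exact hL) n
  rwa [one_mul] at h

/-- Commutative-group bookkeeping for the quadratic iterate. [folklore] -/
private theorem iterate_display_algebra {M : Type*} [CommGroup M] (x L Q : M) (k c m : ℤ) :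
    x * L ^ (-(2 : ℤ)) * Q ^ (-c) * (L * Q ^ k) ^ (-(2 * m)) * Q ^ (-(m * (m - 1) * k + m * c)) =
      x * L ^ (-(2 * (m + 1))) * Q ^ (-((m + 1) * (m + 1 - 1) * k + (m + 1) * c)) := by
  apply Additive.ofMul.injective
  simp only [ofMul_mul, ofMul_zpow]
  module

/-- **Iterated quadratic display**: if `conj σ` fixes `Q`, sends `L ↦ L · Q^k` and `x ↦ x · L^{−2} · Q^{−c}`, then for every
`n ∈ ℤ`, `conj (σ^n) x = x · L^{−2n} · Q^{−(n(n−1)·k + n·c)}` — for `k = c = 1` the exponent is `−n²`: print's «`η̈^Θ ↦ η̈^Θ −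
2a·log(Ü) − (a²/2)·log(q_X)`» for every `a ∈ Z`, from the display at ONE generator. [cite: MochizukiEtTh2009, Prop 1.5 (iii) p.23] -/
theorem conj_zpow_apply_of_display {σ : G} {x L Q : ContH1 φ A H} (hQ : conj φ A σ Q = Q) {k c : ℤ}
    (hL : conj φ A σ L = L * Q ^ k) (hx : conj φ A σ x = x * L ^ (-(2 : ℤ)) * Q ^ (-c)) (n : ℤ) :
    conj φ A (σ ^ n) x = x * L ^ (-(2 * n)) * Q ^ (-(n * (n - 1) * k + n * c)) := by
  refine int_induction_iff (P := fun n => conj φ A (σ ^ n) x = x * L ^ (-(2 * n)) * Q ^ (-(n * (n - 1) * k + n * c)))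
    (by rw [zpow_zero, conj_one_apply]; simp only [mul_zero, zero_mul, zero_add, neg_zero, zpow_zero, mul_one])
    (fun m => ?_) n
  have step : conj φ A σ (x * L ^ (-(2 * m)) * Q ^ (-(m * (m - 1) * k + m * c))) =
      x * L ^ (-(2 * (m + 1))) * Q ^ (-((m + 1) * (m + 1 - 1) * k + (m + 1) * c)) := by
    rw [map_mul, map_mul, map_zpow, map_zpow, hx, hL, hQ]
    exact iterate_display_algebra x L Q k c m
  rw [conj_zpow_add_one_apply]
  constructor
  · intro h
    rw [h, step]
  · intro h
    exact (conj_bijective σ).1 (h.trans step.symm)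

/-- The case `k = 1`: `conj (σ^n) x = x · L^{−2n} · Q^{−(n(n−1) + n·c)}`. [cite: MochizukiEtTh2009, Prop 1.5 (iii) p.23] -/
theorem conj_zpow_apply_of_display_one {σ : G} {x L Q : ContH1 φ A H} (hQ : conj φ A σ Q = Q) {c : ℤ}
    (hL : conj φ A σ L = L * Q) (hx : conj φ A σ x = x * L ^ (-(2 : ℤ)) * Q ^ (-c)) (n : ℤ) :
    conj φ A (σ ^ n) x = x * L ^ (-(2 * n)) * Q ^ (-(n * (n - 1) + n * c)) := by
  have h := conj_zpow_apply_of_display hQ (k := 1) (by rw [zpow_one]; exact hL) hx n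
  rwa [mul_one] at h

end ContH1

/-! ## The stage-2 model: displays at the powers `σ₀^n` of the deck generator -/

namespace SettingModel

open Literature.AnabelianGeometry.SemiGraphs Literature.AnabelianGeometry.AbsoluteAnabelian

variable (p : ℕ) [Fact p.Prime] (i j : ℤ)

/-- `(γ, 1) ∈ Δ^tp_X`: trivial Galois coordinate. [cite: MochizukiEtTh2009, §1 p.17] -/
theorem aug_inl (hj : Even j) (γ : Gfp) :
    (ThetaSetting.modelχq p i j hj).aug (SemidirectProduct.inl γ : PiTpχq p i j) = 1 := rfl

/-- `(γ, 1)^n ∈ Δ^tp_X`, every `n ∈ ℤ`. [cite: MochizukiEtTh2009, §1 p.17] -/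
theorem aug_inl_zpow (hj : Even j) (γ : Gfp) (n : ℤ) :
    (ThetaSetting.modelχq p i j hj).aug ((SemidirectProduct.inl γ : PiTpχq p i j) ^ n) = 1 := by
  rw [map_zpow, aug_inl, one_zpow]

/-- **`σ₀^n` fixes `Q = κ̈(q̈)`** (every `(i, j)`, every `n`): `Δ^tp_X` acts trivially on the core's unit classes.
[cite: MochizukiEtTh2009, Prop 1.5 (iii) p.23] -/
theorem conj_toTheta_zpow_deckGen_kumYdd_qddUnit (hj : Even j) (hC : (ThetaSetting.modelχq p i j hj).Compat) (n : ℤ) :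
    haveI := hC.GtpYddTheta_normal
    ContH1.conj (MonoidHom.id (ThetaSetting.modelχq p i j hj).GtpTheta) (ThetaSetting.modelχq p i j hj).DeltaTheta
        ((ThetaSetting.modelχq p i j hj).toTheta ((SemidirectProduct.inl (gfpOf (FreeGroup.of 0)) : PiTpχq p i j) ^ n))
        ((kummerCoreχq p i j hj).toKummerData.kumYdd
          ((kummerCoreχq p i j hj).toKummerData.toKddHat (ThetaSetting.modelχq p i j hj).qddUnit)) =
      (kummerCoreχq p i j hj).toKummerData.kumYdd
        ((kummerCoreχq p i j hj).toKummerData.toKddHat (ThetaSetting.modelχq p i j hj).qddUnit) :=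
  conj_kumYdd_qddUnit_of_aug_eq_one p i j hj hC (aug_inl_zpow p i j hj _ n)

/-- **`σ₀^n·log(Ü) = log(Ü)·κ̈(q̈)^n`** at `modelχq p i 2` (every `i`, every `n ∈ ℤ`) — print's «`log(Ü) ↦ log(Ü) + (a/2)·log(q_X)`»
for EVERY `a = n ∈ Z`, iterated from abc-iut-L2-t6's one-step display. [cite: MochizukiEtTh2009, Prop 1.5 (iii) p.23] -/
theorem conj_toTheta_zpow_deckGen_logUdd (hC : (ThetaSetting.modelχq p i 2 even_two).Compat) (n : ℤ) :
    haveI := hC.GtpYddTheta_normal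
    ContH1.conj (MonoidHom.id (ThetaSetting.modelχq p i 2 even_two).GtpTheta) (ThetaSetting.modelχq p i 2 even_two).DeltaTheta
        ((ThetaSetting.modelχq p i 2 even_two).toTheta ((SemidirectProduct.inl (gfpOf (FreeGroup.of 0)) : PiTpχq p i 2) ^ n))
        (kummerCoreχq p i 2 even_two).logUdd =
      (kummerCoreχq p i 2 even_two).logUdd *
        (kummerCoreχq p i 2 even_two).toKummerData.kumYdd
          ((kummerCoreχq p i 2 even_two).toKummerData.toKddHat (ThetaSetting.modelχq p i 2 even_two).qddUnit) ^ n := by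
  haveI := hC.GtpYddTheta_normal
  have hL := conj_deckGen_logUdd p i hC
  rw [map_one, map_one, mul_one] at hL
  rw [map_zpow]
  exact ContH1.conj_zpow_apply_of_mul (conj_kumYdd_qddUnit_of_aug_eq_one p i 2 even_two hC (aug_inl p i 2 even_two _)) hL n

/-- **`σ₀^n·x′ = x′·log(Ü)^{−2n}·κ̈(q̈)^{−(n(n−1) + n·i)}`** at `modelχq p i 2` for the `z`-class `x′ = zClassYddχq` (every `i`,
every `n ∈ ℤ`), iterated from this seat's gen-6 one-step display `σ₀·x′ = x′·log(Ü)^{−2}·κ̈(q̈)^{−i}` and `σ₀·log(Ü) = log(Ü)·κ̈(q̈)`.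
[cite: MochizukiEtTh2009, Prop 1.5 (iii) p.23] -/
theorem conj_toTheta_zpow_deckGen_zClassYddχq (hC : (ThetaSetting.modelχq p i 2 even_two).Compat) (n : ℤ) :
    haveI := hC.GtpYddTheta_normal
    ContH1.conj (MonoidHom.id (ThetaSetting.modelχq p i 2 even_two).GtpTheta) (ThetaSetting.modelχq p i 2 even_two).DeltaTheta
        ((ThetaSetting.modelχq p i 2 even_two).toTheta ((SemidirectProduct.inl (gfpOf (FreeGroup.of 0)) : PiTpχq p i 2) ^ n))
        (zClassYddχq p i 2 even_two) =
      zClassYddχq p i 2 even_two * (kummerCoreχq p i 2 even_two).logUdd ^ (-(2 * n)) *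
        (kummerCoreχq p i 2 even_two).toKummerData.kumYdd
          ((kummerCoreχq p i 2 even_two).toKummerData.toKddHat (ThetaSetting.modelχq p i 2 even_two).qddUnit) ^
            (-(n * (n - 1) + n * i)) := by
  haveI := hC.GtpYddTheta_normal
  have hL := conj_deckGen_logUdd p i hC
  rw [map_one, map_one, mul_one] at hL
  rw [map_zpow]
  exact ContH1.conj_zpow_apply_of_display_one
    (conj_kumYdd_qddUnit_of_aug_eq_one p i 2 even_two hC (aug_inl p i 2 even_two _)) hL
    (conj_deckGen_zClassYddχq_gen p i 2 even_two hC) n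

/-- Commutative-group bookkeeping for the twisted lift. [folklore] -/
private theorem twistLift_algebra {M : Type*} [CommGroup M] (x L Q : M) (i n m : ℤ) :
    x * L ^ (-(2 * n)) * Q ^ (-(n * (n - 1) + n * i)) * (L * Q ^ n) ^ m =
      x * L ^ m * L ^ (-(2 * n)) * Q ^ (-(n * (n - 1) + n * i - n * m)) := by
  apply Additive.ofMul.injective
  simp only [ofMul_mul, ofMul_zpow]
  module

/-- **The TWISTED lift `x_m := x′·log(Ü)^m` under `σ₀^n`** at `modelχq p i 2` (every `i`, `n`, `m`):
`σ₀^n·x_m = x_m·log(Ü)^{−2n}·κ̈(q̈)^{−(n(n−1) + n·i − n·m)}`. [cite: MochizukiEtTh2009, Prop 1.5 (iii) p.23] -/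
theorem conj_toTheta_zpow_deckGen_twistLift (hC : (ThetaSetting.modelχq p i 2 even_two).Compat) (n m : ℤ) :
    haveI := hC.GtpYddTheta_normal
    ContH1.conj (MonoidHom.id (ThetaSetting.modelχq p i 2 even_two).GtpTheta) (ThetaSetting.modelχq p i 2 even_two).DeltaTheta
        ((ThetaSetting.modelχq p i 2 even_two).toTheta ((SemidirectProduct.inl (gfpOf (FreeGroup.of 0)) : PiTpχq p i 2) ^ n))
        (zClassYddχq p i 2 even_two * (kummerCoreχq p i 2 even_two).logUdd ^ m) =
      zClassYddχq p i 2 even_two * (kummerCoreχq p i 2 even_two).logUdd ^ m *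
        (kummerCoreχq p i 2 even_two).logUdd ^ (-(2 * n)) *
        (kummerCoreχq p i 2 even_two).toKummerData.kumYdd
          ((kummerCoreχq p i 2 even_two).toKummerData.toKddHat (ThetaSetting.modelχq p i 2 even_two).qddUnit) ^
            (-(n * (n - 1) + n * i - n * m)) := by
  haveI := hC.GtpYddTheta_normal
  rw [map_mul, map_zpow (ContH1.conj _ _ _), conj_toTheta_zpow_deckGen_zClassYddχq p i hC n,
    conj_toTheta_zpow_deckGen_logUdd p i hC n]
  exact twistLift_algebra _ _ _ i n m

/-- **On the line `m = i − 1`: `σ₀^n·x_{i−1} = x_{i−1}·log(Ü)^{−2n}·κ̈(q̈)^{−n²}`** at `modelχq p i 2` (every `i`, every `n ∈ ℤ`) —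
print's display «`η̈^Θ ↦ η̈^Θ − 2a·log(Ü) − (a²/2)·log(q_X) + log(O^×_K̈)`» for EVERY `a = n`, with TRIVIAL unit, for the lift
of the twisted class `η̈♯·infl(log Ü)^{i−1}` (the `(i, m) = (1, 0)` case is abc-iut-L2-t6's Tate instance, `(2, 1)` is p501580's).
[cite: MochizukiEtTh2009, Prop 1.5 (iii) p.23] -/
theorem conj_toTheta_zpow_deckGen_twistLift_line (hC : (ThetaSetting.modelχq p i 2 even_two).Compat) (n : ℤ) :
    haveI := hC.GtpYddTheta_normal
    ContH1.conj (MonoidHom.id (ThetaSetting.modelχq p i 2 even_two).GtpTheta) (ThetaSetting.modelχq p i 2 even_two).DeltaTheta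
        ((ThetaSetting.modelχq p i 2 even_two).toTheta ((SemidirectProduct.inl (gfpOf (FreeGroup.of 0)) : PiTpχq p i 2) ^ n))
        (zClassYddχq p i 2 even_two * (kummerCoreχq p i 2 even_two).logUdd ^ (i - 1)) =
      zClassYddχq p i 2 even_two * (kummerCoreχq p i 2 even_two).logUdd ^ (i - 1) *
        (kummerCoreχq p i 2 even_two).logUdd ^ (-(2 * n)) *
        (kummerCoreχq p i 2 even_two).toKummerData.kumYdd
          ((kummerCoreχq p i 2 even_two).toKummerData.toKddHat (ThetaSetting.modelχq p i 2 even_two).qddUnit) ^ (-(n * n)) := by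
  rw [conj_toTheta_zpow_deckGen_twistLift p i hC n (i - 1)]
  congr 2
  ring

/-- **Re-centring display for `log(Ü)`**: `σ₀^{1−i}·log(Ü) = log(Ü)·κ̈(q̈)^{1−i}` at `modelχq p i 2`.
[cite: MochizukiEtTh2009, Prop 1.5 (iii) p.23] -/
theorem conj_toTheta_deckGen_zpow_one_sub_logUdd (hC : (ThetaSetting.modelχq p i 2 even_two).Compat) :
    haveI := hC.GtpYddTheta_normal
    ContH1.conj (MonoidHom.id (ThetaSetting.modelχq p i 2 even_two).GtpTheta) (ThetaSetting.modelχq p i 2 even_two).DeltaTheta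
        ((ThetaSetting.modelχq p i 2 even_two).toTheta
          ((SemidirectProduct.inl (gfpOf (FreeGroup.of 0)) : PiTpχq p i 2) ^ (1 - i)))
        (kummerCoreχq p i 2 even_two).logUdd =
      (kummerCoreχq p i 2 even_two).logUdd *
        (kummerCoreχq p i 2 even_two).toKummerData.kumYdd
          ((kummerCoreχq p i 2 even_two).toKummerData.toKddHat (ThetaSetting.modelχq p i 2 even_two).qddUnit) ^ (1 - i) :=
  conj_toTheta_zpow_deckGen_logUdd p i hC (1 - i)

/-- **Re-centring display for the `z`-class: `σ₀^{1−i}·x′ = x′·log(Ü)^{2(i−1)}` EXACTLY** at `modelχq p i 2` — the `κ̈(q̈)`-exponent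
`−(n(n−1) + n·i)` VANISHES at `n = 1 − i` (p505401's `(2, 2)` case: `σ₀⁻¹·x′ = x′·log(Ü)²`). [cite: MochizukiEtTh2009, Prop 1.5 (iii) p.23] -/
theorem conj_toTheta_deckGen_zpow_one_sub_zClassYddχq (hC : (ThetaSetting.modelχq p i 2 even_two).Compat) :
    haveI := hC.GtpYddTheta_normal
    ContH1.conj (MonoidHom.id (ThetaSetting.modelχq p i 2 even_two).GtpTheta) (ThetaSetting.modelχq p i 2 even_two).DeltaTheta
        ((ThetaSetting.modelχq p i 2 even_two).toTheta
          ((SemidirectProduct.inl (gfpOf (FreeGroup.of 0)) : PiTpχq p i 2) ^ (1 - i)))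
        (zClassYddχq p i 2 even_two) =
      zClassYddχq p i 2 even_two * (kummerCoreχq p i 2 even_two).logUdd ^ (2 * (i - 1)) := by
  rw [conj_toTheta_zpow_deckGen_zClassYddχq p i hC (1 - i),
    show -((1 - i) * (1 - i - 1) + (1 - i) * i) = 0 by ring, zpow_zero, mul_one]
  congr 2
  ring

/-! ## The defect of the inversion of record on `log(Ü)` at general `(i, j)` -/

/-- On coordinates (every `i`, even `j`): `ŷ(ι⁻¹ g)/2 + (i − j/2)·κ_p(g) + ŷ(g)/2 = 0` additively — from abc-iut-w5-d249's
`ŷ(ι g) = ŷ(g)⁻¹ · κ_p(g)^{−i −i + j}`. [cite: MochizukiEtTh2009, Prop 1.5 (iii) p.23] -/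
theorem half_yThetaχq_inversionχq_symm_mul_gen (hj : Even j) (g : PiTpχq p i j)
    (h₁ : yThetaχq p i j ((ThetaSetting.modelχq p i j hj).toTheta ((inversionχq p i j).toMulEquiv.symm g)) ∈ sqHom.range)
    (h₃ : yThetaχq p i j ((ThetaSetting.modelχq p i j hj).toTheta g) ∈ sqHom.range) :
    half ⟨_, h₁⟩ *
        (kappaP p (CurveTheta.augTheta (curveχq p i j) ((ThetaSetting.modelχq p i j hj).toTheta g)) ^ (i - j / 2) *
          half ⟨_, h₃⟩) = 1 := by
  have hj2 : (i - j / 2) * 2 = i + i - j := by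
    have := Int.two_mul_ediv_two_of_even hj
    omega
  apply sqHom_injective
  rw [map_mul, map_mul, map_one, sqHom_apply, sqHom_apply, sqHom_apply, half_sq, half_sq, ← zpow_natCast, ← zpow_mul,
    Nat.cast_ofNat, hj2]
  change yThetaχq p i j (CurveTheta.toTheta (curveχq p i j) ((inversionχq p i j).symm g)) *
      (kappaP p ((curveχq p i j).aug g) ^ (i + i - j) * yThetaχq p i j (CurveTheta.toTheta (curveχq p i j) g)) = 1
  rw [inversionχq_symm_apply, yThetaχq_toTheta, yThetaχq_toTheta, yCoordχq_inversionχq, invDefect_tatePairHom]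
  change (yCoordχq p i j g)⁻¹ * kappaP p g.right ^ (-i + -i + j) * (kappaP p g.right ^ (i + i - j) * yCoordχq p i j g) = 1
  rw [← mul_assoc, mul_assoc _ (kappaP p g.right ^ (-i + -i + j)), ← zpow_add,
    show -i + -i + j + (i + i - j) = 0 by ring, zpow_zero, mul_one, inv_mul_cancel]

/-- The same in `Δ_Θ`, with the middle term the `(i − j/2)`-th power of the Kummer COCYCLE of `q̈`:
`log(Ü)(ι⁻¹ x) · κ̈(q̈)(x)^{i − j/2} · log(Ü)(x) = 1` pointwise on `Π^tp_Ÿ`. [cite: MochizukiEtTh2009, Prop 1.5 (iii) p.23] -/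
theorem logUddFun_inversionχq_symm_mul_gen (hj : Even j) (x : ↥(ThetaSetting.modelχq p i j hj).GtpYdd) :
    letI := (ThetaSetting.modelχq p i j hj).unitsAction (kummerCoreχq p i j hj).augTheta
    (yCoordKitχq p i j hj).logUddFun
        ⟨(ThetaSetting.modelχq p i j hj).toTheta ((inversionχq p i j).toMulEquiv.symm (x : PiTpχq p i j)),
          ⟨_, ThetaSetting.symm_mem_GtpYdd (isInversionAut_inversionχq p i j hj).thm16i x, rfl⟩⟩ *
      ((((kummerCoreχq p i j hj).coeff.kummerContCocycle
          ((ThetaSetting.modelχq p i j hj).GtpYdd.map (ThetaSetting.modelχq p i j hj).toTheta)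
          ((pRoots p).cast (pUnit_eq_toInvYdd_qddUnit p i j hj))
          ((kummerCoreχq p i j hj).toInvYdd (ThetaSetting.modelχq p i j hj).qddUnit).2
          (fun _ => (kummerCoreχq p i j hj).isOpen_stabilizer' _)).1
          ⟨(ThetaSetting.modelχq p i j hj).toTheta (x : PiTpχq p i j), ⟨x.1, x.2, rfl⟩⟩) ^ (i - j / 2) *
        (yCoordKitχq p i j hj).logUddFun
          ⟨(ThetaSetting.modelχq p i j hj).toTheta (x : PiTpχq p i j), ⟨x.1, x.2, rfl⟩⟩) = 1 := by
  letI := (ThetaSetting.modelχq p i j hj).unitsAction (kummerCoreχq p i j hj).augTheta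
  apply Subtype.ext
  rw [Subgroup.coe_mul, Subgroup.coe_mul, Subgroup.coe_one, SubgroupClass.coe_zpow, coe_kummerContCocycle_qdd_apply,
    coe_logUddFun_yCoordKitχq, coe_logUddFun_yCoordKitχq, ← map_zpow (cThetaχq p i j), ← map_mul (cThetaχq p i j),
    ← map_mul (cThetaχq p i j), half_yThetaχq_inversionχq_symm_mul_gen p i j hj, map_one]

/-- **`ι_* infl(log Ü) = infl(log Ü)^{−1} · infl(κ̈(q̈))^{j/2 − i}` on `Π^tp_Ÿ` at `modelχq p i j`** (every `i`, every even `j`), for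
EVERY theta companion of the inversion OF RECORD `ι = inversionχq p i j`: the DEFECT of clause (b) of Prop. 1.5 (iii) for `ι`
is the Kummer class of `q̈^{j/2 − i}` (zero exactly on abc-iut-L2-d1's line `j = 2i`; p505401 = the point `(2, 2)`).
[cite: MochizukiEtTh2009, Prop 1.5 (iii) p.23] -/
theorem transport_inflTheta_logUdd_kummerCoreχq_gen (hj : Even j)
    (cι : ThetaSetting.ThetaCompanion (Dα := ThetaSetting.modelχq p i j hj) (Dβ := ThetaSetting.modelχq p i j hj)
      (inversionχq p i j)) :
    ThetaSetting.transport cι (isInversionAut_inversionχq p i j hj).thm16i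
        ((ThetaSetting.modelχq p i j hj).inflTheta (ThetaSetting.modelχq p i j hj).GtpYdd (kummerCoreχq p i j hj).logUdd) =
      ((ThetaSetting.modelχq p i j hj).inflTheta (ThetaSetting.modelχq p i j hj).GtpYdd (kummerCoreχq p i j hj).logUdd)⁻¹ *
        (ThetaSetting.modelχq p i j hj).inflTheta (ThetaSetting.modelχq p i j hj).GtpYdd
          ((kummerCoreχq p i j hj).toKummerData.kumYdd
            ((kummerCoreχq p i j hj).toKummerData.toKddHat (ThetaSetting.modelχq p i j hj).qddUnit)) ^ (j / 2 - i) := by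
  letI := (ThetaSetting.modelχq p i j hj).unitsAction (kummerCoreχq p i j hj).augTheta
  -- `ι_*L = L⁻¹ · Q^{j/2 − i}` ⟸ `ι_*L · (Q^{i − j/2} · L) = 1`
  rw [show j / 2 - i = -(i - j / 2) by ring, zpow_neg, ← mul_inv_rev, eq_inv_iff_mul_eq_one, ← map_zpow,
    kumYdd_toKddHat_qddUnit_eq_mk]
  change ContH1.mk _ _ * (ContH1.mk _ _ * ContH1.mk _ _) = 1
  rw [ContH1.mk_mul_mk, ContH1.mk_mul_mk, ← ContH1.mk_one]
  refine ContH1.mk_congr _ (funext fun x => ?_) _ _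
  rw [Pi.mul_apply, Pi.mul_apply, Pi.one_apply, (isInversionAut_inversionχq p i j hj).transportFun_apply cι]
  exact logUddFun_inversionχq_symm_mul_gen p i j hj x

end SettingModel

end Literature.AnabelianGeometry.EtaleTheta

end
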